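import Summits.BirchSwinnertonDyer.BirchSwinnertonDyer.Theorems.PrintCFramBottomClassIndexLawFiveLeFlipRungVehicleInvariance
import Summits.BirchSwinnertonDyer.BirchSwinnertonDyer.Theorems.PrintCFramBottomClassIndexLawFiveLeFlipRungTwistVehicle
import Summits.BirchSwinnertonDyer.BirchSwinnertonDyer.Theorems.PrintCFramBottomClassIndexLawFiveLeCutFormCohenProduct
import HarnessLib

set_option autoImplicit false

/-!
# Crux `PrintCFram.BottomClassIndexLawFiveLe` (stmt-BirchSwinnertonDyer-20372), line `eisenstein-resource-bdp-line` (registry v27/v28):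
# the typing of `stub_flipRung`, modular assembly, part 2 — THE VEHICLE `F₀` OF THE FLIPPED-CUSP RUNG, WITH `hinv` AND ITS q-EXPANSION
# (cell `bsd-print-cfram`, width seat `bsd-line-cfram-p1-w4` g19; THEOREMS ONLY, `--supports` 20372; BSD is not proved by any of this)

HONEST FRAMING. Nothing here is a statement about elliptic curves, Bernoulli numbers or BSD; no registered stub is closed. CONDITIONAL on
the cite-only named fact NF-A `Cohen1975.thm31_cohenSeries_mem_halfIntModularForms` (Cohen 1975 Thm 3.1), as every vehicle of this line.
This file assembles, BY NAME, the vehicle that T3 (`…FlipRungSlash`, `…FlipRungSlashCoeff`) reads at the flipped cusp: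

* §1 `exists_translateWeights_of_periodic` — finite Fourier inversion on `ℤ/Q`: for a `Q`-periodic `a : ℕ → ℂ` there are weights
  `b : ℤ/Q → ℂ` with `Σ_j b(j)·ψ_Q(j·n) = a(n)` (Mathlib `ZMod.dft`; the tree's `PeriodicTwist` keeps this private).
* §2 **`exists_flipVehicle`** — for `k ≥ 2`, a prime `q`, `Q₀ ≥ 1`, and ANY weights `b : ℤ/Q₀ → ℂ`: a modular form
  `g : ModularForm (Γ₁(4(qQ₀)²·Q₀²)) (k+1)` and `Θ : PowerSeries ℕ` (the coefficients of `θ((qQ₀)²·)`: `Θ₀ = 1`, support in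
  `(qQ₀)²·□`) with (i) `g(z) = Σ_j b(j)·(H_k·θ((qQ₀)²·))(z + j/Q₀)` (w3 g19 `exists_modularForm_translateSum_coe_eq` on w8 g7's
  `exists_modularForm_cohen_mul_thetaMul_sq_pow_qExpansion`), (ii) `coeff n (qExpansion 1 g) = (Σ_j b(j)ψ_{Q₀}(jn)) · ((H_k ⋆ Θ)(n) : ℚ)`,
  (iii) **`hinv`**: `⇑g ∣_{k+1} γ = ⇑g` for every `γ ∈ SL₂(ℤ)` with `4Q₀⁴·q² ∣ γ₁₀`, `4Q₀⁴ ∣ γ₁₁ − 1` ((G3) `vehicle_slash_eq` on the base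
  `H_k·θ((qQ₀)²·) ∈ M_{(2k+2)/2}(4(qQ₀)², 1)` — w8 g7 `mul_mem_halfIntModularForms`, `mem_halfIntModularForms_of_dvd`,
  `thetaMul_sq_mem_halfIntModularForms`).
* §3 `exists_flipVehicle_of_periodic` — the same with `b` chosen for a `Q₀`-periodic `0/1` cut `AWAY` (§1), so that
  `coeff n (qExpansion 1 g) = ((𝟙_AWAY·H_k) ⋆ Θ)(n)` read in `ℚ` (w3 g12 `PowerSeries.coeff_mul_eq_mul_coeff_mul_of_periodic`: the theta
  support is `≡ 0 (mod Q₀)`), i.e. exactly the series `mk a * map Θ`, `a := 𝟙_AWAY·cohenH k`, of w8 g9's (JML⁶).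
beyond-print theorem: NO.

References: [Cohen1975] Thm. 3.1; [Shimura1971] Prop. 3.64; [Shimura1973HalfIntegral] §1; crux notes lead-g14 §2.5.
-/

-- summit-side namespace `Summit.BirchSwinnertonDyer.BirchSwinnertonDyer.…` (single-conjunct summit, D-0017 layout)
set_option linter.dupNamespace false

noncomputable section

open scoped MatrixGroups ModularForm Real Classical
open UpperHalfPlane hiding I
open Complex CongruenceSubgroup Function PowerSeries
open Literature.NumberTheory.EllipticCurves.ModularForms
open Literature.NumberTheory.EllipticCurves.Tunnell1983
open Literature.NumberTheory.ModularForms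
open Literature.NumberTheory.ModularForms.CohenEisenstein (cohenH)

namespace Summit.BirchSwinnertonDyer.BirchSwinnertonDyer.Theorems.PrintCFram.FlipRung

open Summit.BirchSwinnertonDyer.BirchSwinnertonDyer.Theorems.PrintCFram.HalfIntegralBridge

/-! ## §1 Translate weights for a periodic multiplier (finite Fourier inversion) -/

/-- **Finite Fourier inversion on `ℤ/Q`.** For `Q ≥ 1` and a `Q`-periodic `a : ℕ → ℂ` there are weights `b : ℤ/Q → ℂ` with
`Σ_{j mod Q} b(j)·ψ_Q(j·n) = a(n)` for every `n : ℕ` (`ψ_Q = ZMod.stdAddChar`; `b = Q⁻¹·𝓕a`, Mathlib `ZMod.dft`/`ZMod.invDFT_apply`).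
[cite: Shimura1971, Prop. 3.64] -/
theorem exists_translateWeights_of_periodic {Q : ℕ} [NeZero Q] (a : ℕ → ℂ) (ha : Function.Periodic a Q) :
    ∃ b : ZMod Q → ℂ, ∀ n : ℕ, ∑ j : ZMod Q, b j * ZMod.stdAddChar (j * (n : ZMod Q)) = a n := by
  -- descend `a` to `ℤ/Q`
  let a' : ZMod Q → ℂ := fun x ↦ a x.val
  have ha' : ∀ n : ℕ, a' (n : ZMod Q) = a n := fun n ↦ by
    show a ((n : ZMod Q).val) = a n
    rw [ZMod.val_natCast]
    exact ha.map_mod_nat n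
  have hQ : (Q : ℂ) ≠ 0 := Nat.cast_ne_zero.mpr (NeZero.ne Q)
  refine ⟨(Q : ℂ)⁻¹ • ZMod.dft a', fun n ↦ ?_⟩
  have h1 := ZMod.invDFT_apply ((Q : ℂ)⁻¹ • ZMod.dft a') (n : ZMod Q)
  rw [LinearEquiv.map_smul, LinearEquiv.symm_apply_apply, Pi.smul_apply, smul_eq_mul, smul_eq_mul] at h1
  have h2 := congrArg (fun z : ℂ ↦ (Q : ℂ) * z) h1
  simp only [← mul_assoc, mul_inv_cancel₀ hQ, one_mul] at h2
  rw [← ha' n, h2]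
  exact Finset.sum_congr rfl fun j _ ↦ by rw [smul_eq_mul, mul_comm]

/-! ## §2 The vehicle: a translate average of `H_k · θ((qQ₀)²·)`, as a `Γ₁`-modular form with `hinv` and its q-expansion -/

/-- **THE VEHICLE OF THE FLIPPED-CUSP RUNG.** Assume NF-A (Cohen 1975 Thm 3.1, cite-only). For `k ≥ 2`, `q ≥ 1`, `Q₀ ≥ 1` and ANY
weights `b : ℤ/Q₀ → ℂ` there are a modular form `g` of weight `k + 1` on `Γ₁(4(qQ₀)²·Q₀²)` and `Θ : PowerSeries ℕ` (the q-coefficients of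
`θ((qQ₀)²·)`: `Θ₀ = 1`, support in `(qQ₀)²·□`) such that: (i) `g(z) = Σ_j b(j)·(H·θ_{(qQ₀)²})(z + j/Q₀)` for the Cohen–Eisenstein series
`H = H_k` of NF-A (`qCoeffs H N = H(k, N)`); (ii) `coeff n (qExpansion 1 g) = (Σ_j b(j)ψ_{Q₀}(j·n)) · (((mk (cohenH k) * Θ) n : ℚ) : ℂ)`;
(iii) **`hinv`** — `⇑g ∣_{k+1} γ = ⇑g` for every `γ ∈ SL₂(ℤ)` with `(4Q₀⁴)·q² ∣ γ₁₀` and `4Q₀⁴ ∣ γ₁₁ − 1` (T3's hypothesis with `M = 4Q₀⁴`).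
Ingredients by name: w8 g7 `exists_modularForm_cohen_mul_thetaMul_sq_pow_qExpansion` (the base form, `p = 1`) and §1/§4 of
`…HalfIntegralBridge` (membership of `H·θ` in `M_{(2k+2)/2}(4(qQ₀)², 1)`), w3 g19 `exists_modularForm_translateSum_coe_eq` (the translate
average as a `Γ₁`-form with exposed function and coefficients), (G3) `vehicle_slash_eq`. CONDITIONAL on NF-A.
[cite: Cohen1975, Thm. 3.1] [cite: Shimura1971, Prop. 3.64] [cite: Shimura1973HalfIntegral, §1] -/
theorem exists_flipVehicle (hA : Cohen1975.thm31_cohenSeries_mem_halfIntModularForms) {k : ℕ} (hk : 2 ≤ k) {q Q₀ : ℕ}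
    [NeZero Q₀] (hq : 0 < q) (b : ZMod Q₀ → ℂ) :
    ∃ (g : ModularForm (Gamma1 (4 * (q * Q₀) ^ 2 * Q₀ ^ 2)) ((k + 1 : ℕ) : ℤ)) (Θ : PowerSeries ℕ),
      PowerSeries.coeff 0 Θ = 1 ∧ (∀ n : ℕ, PowerSeries.coeff n Θ ≠ 0 → ∃ m : ℕ, n = (q * Q₀) ^ 2 * m ^ 2) ∧
      (∀ z : ℍ, g z = ∑ j : ZMod Q₀, b j *
        ((Classical.choose (hA k hk)) (((j.val : ℝ) / (Q₀ : ℝ)) +ᵥ z) * thetaMul ((q * Q₀) ^ 2) (((j.val : ℝ) / (Q₀ : ℝ)) +ᵥ z))) ∧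
      (∀ n : ℕ, (qExpansion 1 ⇑g).coeff n =
        (∑ j : ZMod Q₀, b j * ZMod.stdAddChar (j * (n : ZMod Q₀))) *
          ((PowerSeries.coeff n (PowerSeries.mk (cohenH k) * PowerSeries.map (Nat.castRingHom ℚ) Θ) : ℚ) : ℂ)) ∧
      (∀ γ : SL(2, ℤ), (4 * (Q₀ : ℤ) ^ 4) * (q : ℤ) ^ 2 ∣ γ 1 0 → 4 * (Q₀ : ℤ) ^ 4 ∣ γ 1 1 - 1 →
        ((g : ℍ → ℂ) ∣[((k + 1 : ℕ) : ℤ)] γ) = (g : ℍ → ℂ)) := by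
  have hQ₀ : 0 < Q₀ := Nat.pos_of_ne_zero (NeZero.ne Q₀)
  have hQ : 0 < q * Q₀ := Nat.mul_pos hq hQ₀
  haveI : NeZero (4 * (q * Q₀) ^ 2) := ⟨Nat.mul_ne_zero (by norm_num) (pow_ne_zero 2 hQ.ne')⟩
  -- the base form `f = H · θ((qQ₀)²·)` of weight `k + 1` on `Γ₁(4(qQ₀)²)`
  obtain ⟨f, Θ, hfq, hΘ0, hΘsupp, hfz⟩ := exists_modularForm_cohen_mul_thetaMul_sq_pow_qExpansion hA hQ hk odd_one
  -- its function is a member of `M_{(2k+2)/2}(4(qQ₀)², 1)`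
  set H : ℍ → ℂ := Classical.choose (hA k hk) with hHdef
  have hH : H ∈ halfIntModularForms (2 * k + 1) 4 1 := (Classical.choose_spec (hA k hk)).1
  have hfun : ⇑f = H * thetaMul ((q * Q₀) ^ 2) := by
    funext z; rw [hfz z, pow_one]; rfl
  have hmem : (⇑f : ℍ → ℂ) ∈ halfIntModularForms (2 * (k + 1)) (4 * (q * Q₀) ^ 2)
      (1 : DirichletCharacter ℂ (4 * (q * Q₀) ^ 2)) := by
    have h4 : 4 ∣ 4 * (q * Q₀) ^ 2 := dvd_mul_right 4 _
    have hH' := mem_halfIntModularForms_of_dvd h4 hH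
    rw [DirichletCharacter.changeLevel_one] at hH'
    have hθ := thetaMul_sq_mem_halfIntModularForms (Q := q * Q₀) hQ
    have hprod := mul_mem_halfIntModularForms hH' hθ
    rw [mul_one, show 2 * k + 1 + 1 = 2 * (k + 1) by ring] at hprod
    rwa [hfun]
  -- the translate average `g`
  obtain ⟨g, hgz, hgq⟩ := exists_modularForm_translateSum_coe_eq f Q₀ b
  refine ⟨g, Θ, hΘ0, hΘsupp, fun z ↦ ?_, fun n ↦ ?_, fun γ hc hd ↦ ?_⟩
  · -- (i) the function
    rw [hgz z]
    refine Finset.sum_congr rfl fun j _ ↦ ?_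
    rw [hfz, pow_one]
  · -- (ii) the q-expansion
    rw [hgq n, hfq, PowerSeries.coeff_map, pow_one]
    rfl
  · -- (iii) `hinv` from (G3)
    have hgfun : (⇑g : ℍ → ℂ) = fun z : ℍ ↦ ∑ j : ZMod Q₀, b j * (⇑f) (((j.val : ℝ) / (Q₀ : ℝ)) +ᵥ z) := funext hgz
    rw [hgfun]
    exact vehicle_slash_eq (q := q) (Q₀ := Q₀) hq.ne' (κ := k + 1) hmem b γ hc hd


/-! ## §3 The vehicle of a periodic `0/1` cut: coefficients `((𝟙_AWAY · H_k) ⋆ Θ)(n)` -/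

/-- **THE VEHICLE OF A PERIODIC CUT** (the away-from-`q` `τ`-cut of w8 g9's T5 layer B): assume NF-A; for `k ≥ 2`, `q ≥ 1`, `Q₀ ≥ 1` and a
decidable `Q₀`-PERIODIC predicate `AWAY` on `ℕ` there are `g : ModularForm (Γ₁(4(qQ₀)²·Q₀²)) (k+1)`, `Θ` (coefficients of `θ((qQ₀)²·)`:
`Θ₀ = 1`, support in `(qQ₀)²·□`) and weights `b : ℤ/Q₀ → ℂ` with: `g(z) = Σ_j b(j)·(H_k·θ_{(qQ₀)²})(z + j/Q₀)`;
**`coeff n (qExpansion 1 g) = ((coeff n (mk (𝟙_AWAY · cohenH k) * Θ) : ℚ) : ℂ)`** — EXACTLY the rational series `mk a * map Θ`,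
`a i = cohenH k i` on `AWAY` and `0` off it, of (JML⁶); and T3's `hinv` for `M = 4Q₀⁴`. The weights are the Fourier inversion of
`𝟙_AWAY` (§1); the cut commutes with the theta factor because its support is `≡ 0 (mod Q₀)` (w3 g12
`PowerSeries.coeff_mul_eq_mul_coeff_mul_of_periodic`). CONDITIONAL on NF-A. [cite: Cohen1975, Thm. 3.1] [cite: Shimura1971, Prop. 3.64] -/
theorem exists_flipVehicle_of_periodic (hA : Cohen1975.thm31_cohenSeries_mem_halfIntModularForms) {k : ℕ} (hk : 2 ≤ k) {q Q₀ : ℕ}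
    [NeZero Q₀] (hq : 0 < q) (AWAY : ℕ → Prop) [DecidablePred AWAY] (hper : Function.Periodic AWAY Q₀) :
    ∃ (g : ModularForm (Gamma1 (4 * (q * Q₀) ^ 2 * Q₀ ^ 2)) ((k + 1 : ℕ) : ℤ)) (Θ : PowerSeries ℕ) (b : ZMod Q₀ → ℂ),
      PowerSeries.coeff 0 Θ = 1 ∧ (∀ n : ℕ, PowerSeries.coeff n Θ ≠ 0 → ∃ m : ℕ, n = (q * Q₀) ^ 2 * m ^ 2) ∧
      (∀ z : ℍ, g z = ∑ j : ZMod Q₀, b j *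
        ((Classical.choose (hA k hk)) (((j.val : ℝ) / (Q₀ : ℝ)) +ᵥ z) * thetaMul ((q * Q₀) ^ 2) (((j.val : ℝ) / (Q₀ : ℝ)) +ᵥ z))) ∧
      (∀ n : ℕ, (qExpansion 1 ⇑g).coeff n =
        ((PowerSeries.coeff n (PowerSeries.mk (fun i : ℕ ↦ if AWAY i then cohenH k i else 0) *
            PowerSeries.map (Nat.castRingHom ℚ) Θ) : ℚ) : ℂ)) ∧
      (∀ γ : SL(2, ℤ), (4 * (Q₀ : ℤ) ^ 4) * (q : ℤ) ^ 2 ∣ γ 1 0 → 4 * (Q₀ : ℤ) ^ 4 ∣ γ 1 1 - 1 →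
        ((g : ℍ → ℂ) ∣[((k + 1 : ℕ) : ℤ)] γ) = (g : ℍ → ℂ)) := by
  have hQ₀ : 0 < Q₀ := Nat.pos_of_ne_zero (NeZero.ne Q₀)
  -- the weights: Fourier inversion of the indicator of `AWAY`
  have hperC : Function.Periodic (fun n : ℕ ↦ if AWAY n then (1 : ℂ) else 0) Q₀ := fun n ↦ by
    simp only [hper n]
  obtain ⟨b, hb⟩ := exists_translateWeights_of_periodic (Q := Q₀) _ hperC
  obtain ⟨g, Θ, hΘ0, hΘsupp, hgz, hgq, hinv⟩ := exists_flipVehicle hA hk (Q₀ := Q₀) hq b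
  refine ⟨g, Θ, b, hΘ0, hΘsupp, hgz, fun n ↦ ?_, hinv⟩
  -- the cut commutes with the theta factor (support `≡ 0 (mod Q₀)`)
  have hperQ : Function.Periodic (fun n : ℕ ↦ if AWAY n then (1 : ℚ) else 0) Q₀ := fun n ↦ by
    simp only [hper n]
  have hψ : ∀ n : ℕ, PowerSeries.coeff n (PowerSeries.mk (fun i : ℕ ↦ if AWAY i then cohenH k i else 0)) =
      (if AWAY n then (1 : ℚ) else 0) * PowerSeries.coeff n (PowerSeries.mk (cohenH k)) := by
    intro n
    rw [PowerSeries.coeff_mk, PowerSeries.coeff_mk]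
    split_ifs <;> simp
  have hT : ∀ j : ℕ, PowerSeries.coeff j (PowerSeries.map (Nat.castRingHom ℚ) Θ) ≠ 0 → Q₀ ∣ j := by
    intro j hj
    rw [PowerSeries.coeff_map] at hj
    have hj' : PowerSeries.coeff j Θ ≠ 0 := fun h ↦ hj (by rw [h, map_zero])
    obtain ⟨m, rfl⟩ := hΘsupp j hj'
    exact ⟨q ^ 2 * Q₀ * m ^ 2, by ring⟩
  rw [hgq n, hb n, PowerSeries.coeff_mul_eq_mul_coeff_mul_of_periodic hperQ hψ hT n]
  push_cast
  split_ifs <;> simp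

end Summit.BirchSwinnertonDyer.BirchSwinnertonDyer.Theorems.PrintCFram.FlipRung

end
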